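import Mathlib
import Summits.ValiantsHypothesis.ValiantsHypothesis.Theorems.BarrierLeverPartitionMinorsHitByVPHiddenStatesJoinFilling

/-!
# Route BarrierLever — item `PartitionMinorsHitByVP` (stmt-ValiantsHypothesis-19717), line `hidden-states`,
# stub `stub_qjoinSharp` (Q_join(h²)): the HUB-JOIN DESIGN — a legal strict-threshold join family beyond the star range

Helper file 1/2 (`--supports stmt-ValiantsHypothesis-19717`; cell valiant-natproofs, rung V4, 𝒟-side door (c); prover seat
val-np-p8 gen 3, lane `stub_qjoinSharp` of the registered line `Cruxes/PartitionMinorsHitByVP/Lines/hidden_states.lean`).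
Bookkeeping defs (`hubStates`, `hubPiece`, `hubE`, `cnt`, `hubW`, `hubWt`); closes NO item.

THE HUB-JOIN DESIGN `hubE` (`m` pieces of `K` states, `l + 1 ≤ K`): piece `p` lists, in this order, the base `∅`, the HUB
`{0}`, the satellites `{1}, …, {K−1}` and the `l` MARRIED PAIRS `{0,1}, …, {0,l}` (block size `B = K+1+l`); the family of size
`r ≤ m·B` is filled piece by piece (`hubE_injective`), and it is a legal STRICT THRESHOLD join family (`hub_threshold`:
members weigh `≤ 3`, non-members `≥ 4` for the natural weights `hubW`/`hubWt`, also on the partially filled piece). It carries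
up to `m·l` columns with TWO states — beyond the star range `m(K+1)` of p578997 (`StarJoin`), which is where
`stub_qjoinSharp` (K = h², m = 2h) has its only content (`r > 2h³ + 2h`). File 2/2 (`…HiddenStatesHubJoinsZeta`) proves that
hub joins are GOOD for every row family with a large parallel class (zeta table), in the stub's shape.

WHAT THIS IS NOT: no goodness statement here (file 2/2); nothing on crux 14610 or VP ≠ VNP.
-/

set_option linter.dupNamespace false

namespace Summit.ValiantsHypothesis.ValiantsHypothesis.Theorems.BarrierLever.HiddenStates

open Finset Matrix

noncomputable section

namespace HubJoin

variable {h m K l r : ℕ}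

/-! ## 1. The hub-join family -/

/-- The states listed at position `j < K+1+l` of a piece: `∅` (j = 0), `{j−1}` (1 ≤ j ≤ K), `{0, j−K}` (K < j). -/
def hubStates (hl : l + 1 ≤ K) (j : ℕ) (hj : j < K + 1 + l) : Finset (Fin K) :=
  if j = 0 then ∅
  else if hjK : j ≤ K then {⟨j - 1, by omega⟩}
  else {⟨0, by omega⟩, ⟨j - K, by omega⟩}

/-- Positions with equal value list the same states (proof-irrelevance helper). -/
theorem hubStates_congr (hl : l + 1 ≤ K) {j j' : ℕ} (hj : j < K + 1 + l) (hj' : j' < K + 1 + l) (h : j = j') :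
    hubStates hl j hj = hubStates hl j' hj' := by
  subst h; rfl

/-- The piece of column `k`: `k / (K+1+l)`. -/
def hubPiece (hr : r ≤ m * (K + 1 + l)) (k : Fin r) : Fin m :=
  ⟨(k : ℕ) / (K + 1 + l), by
    have hk : (k : ℕ) < m * (K + 1 + l) := lt_of_lt_of_le k.2 hr
    exact Nat.div_lt_of_lt_mul (by rwa [Nat.mul_comm] at hk)⟩

/-- Positions are below the block size. -/
theorem pos_lt (K l : ℕ) (k : ℕ) : k % (K + 1 + l) < K + 1 + l := Nat.mod_lt _ (by omega)

/-- **The hub-join family**: column `k` = (piece `k / B`, states at position `k % B`), `B = K+1+l`. -/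
def hubE (hl : l + 1 ≤ K) (hr : r ≤ m * (K + 1 + l)) (k : Fin r) : Fin m × Finset (Fin K) :=
  (hubPiece hr k, hubStates hl ((k : ℕ) % (K + 1 + l)) (pos_lt K l k))

/-- Position `0` lists no state. -/
theorem card_hubStates_zero (hl : l + 1 ≤ K) (j : ℕ) (hj : j < K + 1 + l) (h0 : j = 0) :
    (hubStates hl j hj).card = 0 := by
  simp [hubStates, h0]

/-- Positions `1..K` list one satellite (position `1` is the hub `{0}`). -/
theorem hubStates_single (hl : l + 1 ≤ K) (j : ℕ) (hj : j < K + 1 + l) (h0 : j ≠ 0) (hK : j ≤ K) :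
    hubStates hl j hj = {⟨j - 1, by omega⟩} := by
  simp [hubStates, h0, hK]

/-- Positions beyond `K` list a married pair `{0, j−K}`. -/
theorem hubStates_pair (hl : l + 1 ≤ K) (j : ℕ) (hj : j < K + 1 + l) (hK : K < j) :
    hubStates hl j hj = {⟨0, by omega⟩, ⟨j - K, by omega⟩} := by
  have h0 : j ≠ 0 := by omega
  simp [hubStates, h0, not_le.mpr hK]

/-- Singleton positions have one state. -/
theorem card_hubStates_single (hl : l + 1 ≤ K) (j : ℕ) (hj : j < K + 1 + l) (h0 : j ≠ 0) (hK : j ≤ K) :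
    (hubStates hl j hj).card = 1 := by
  rw [hubStates_single hl j hj h0 hK, Finset.card_singleton]

/-- Pair positions have two states. -/
theorem card_hubStates_pair (hl : l + 1 ≤ K) (j : ℕ) (hj : j < K + 1 + l) (hK : K < j) :
    (hubStates hl j hj).card = 2 := by
  rw [hubStates_pair hl j hj hK, Finset.card_pair]
  intro heq
  have := congrArg Fin.val heq
  simp at this
  omega

/-- The position is determined by the states. -/
theorem hubStates_injective (hl : l + 1 ≤ K) (j j' : ℕ) (hj : j < K + 1 + l) (hj' : j' < K + 1 + l)
    (heq : hubStates hl j hj = hubStates hl j' hj') : j = j' := by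
  have hc := congrArg Finset.card heq
  by_cases h0 : j = 0
  · by_cases h0' : j' = 0
    · omega
    · rw [card_hubStates_zero hl j hj h0] at hc
      by_cases hK' : j' ≤ K
      · rw [card_hubStates_single hl j' hj' h0' hK'] at hc; omega
      · rw [card_hubStates_pair hl j' hj' (not_le.mp hK')] at hc; omega
  · by_cases hK : j ≤ K
    · rw [card_hubStates_single hl j hj h0 hK] at hc
      by_cases h0' : j' = 0
      · rw [card_hubStates_zero hl j' hj' h0'] at hc; omega
      by_cases hK' : j' ≤ K
      · rw [hubStates_single hl j hj h0 hK, hubStates_single hl j' hj' h0' hK'] at heq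
        have := congrArg Fin.val (Finset.singleton_injective heq)
        simp at this
        omega
      · rw [card_hubStates_pair hl j' hj' (not_le.mp hK')] at hc; omega
    · rw [card_hubStates_pair hl j hj (not_le.mp hK)] at hc
      by_cases h0' : j' = 0
      · rw [card_hubStates_zero hl j' hj' h0'] at hc; omega
      by_cases hK' : j' ≤ K
      · rw [card_hubStates_single hl j' hj' h0' hK'] at hc; omega
      · rw [hubStates_pair hl j hj (not_le.mp hK), hubStates_pair hl j' hj' (not_le.mp hK')] at heq
        have hmem : (⟨j - K, by omega⟩ : Fin K) ∈ ({⟨0, by omega⟩, ⟨j' - K, by omega⟩} : Finset (Fin K)) := by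
          rw [← heq]; simp
        rw [Finset.mem_insert, Finset.mem_singleton] at hmem
        rcases hmem with h1 | h1
        · have := congrArg Fin.val h1; simp at this; omega
        · have := congrArg Fin.val h1; simp at this; omega

/-- Division with remainder in the block. -/
theorem div_mul_add_mod' (k B : ℕ) : k / B * B + k % B = k := by
  rw [Nat.mul_comm]; exact Nat.div_add_mod k B

/-- **The hub-join family is injective.** -/
theorem hubE_injective (hl : l + 1 ≤ K) (hr : r ≤ m * (K + 1 + l)) : Function.Injective (hubE hl hr) := by
  intro k k' hkk
  simp only [hubE, Prod.mk.injEq, hubPiece, Fin.mk.injEq] at hkk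
  obtain ⟨hp, hs⟩ := hkk
  have hj := hubStates_injective hl _ _ _ _ hs
  apply Fin.ext
  rw [← div_mul_add_mod' (k : ℕ) (K + 1 + l), ← div_mul_add_mod' (k' : ℕ) (K + 1 + l), hp, hj]

/-! ## 2. The hub-join family is a strict threshold family -/

/-- Number of columns of piece `p` (capped at the block size). -/
def cnt (K l r : ℕ) (p : ℕ) : ℕ := min (r - p * (K + 1 + l)) (K + 1 + l)

/-- Piece weights: empty pieces `4`, a piece holding only its base `3`, otherwise `0`. -/
def hubW (K l r : ℕ) (p : Fin m) : ℕ :=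
  if cnt K l r p = 0 then 4 else if cnt K l r p = 1 then 3 else 0

/-- State weights (see the file header): with `c = cnt p`,
`c = 1`: all `1`; `2 ≤ c ≤ K+1`: `3` for the listed satellites (`q+2 ≤ c`), `4` otherwise;
`c ≥ K+2`: hub `1`, married satellites (`q+K+1 ≤ c`) `2`, the others `3`. -/
def hubWt (K l r : ℕ) (p : Fin m) (q : Fin K) : ℕ :=
  if cnt K l r p ≤ 1 then 1
  else if cnt K l r p ≤ K + 1 then (if (q : ℕ) + 2 ≤ cnt K l r p then 3 else 4)
  else (if (q : ℕ) = 0 then 1 else if (q : ℕ) + K + 1 ≤ cnt K l r p then 2 else 3)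

/-- Membership in the range: `(p, J)` is a column iff `J` is the state set of a position below `cnt p`. -/
theorem mem_range_hubE_iff (hl : l + 1 ≤ K) (hr : r ≤ m * (K + 1 + l)) (p : Fin m) (J : Finset (Fin K)) :
    (p, J) ∈ Set.range (hubE hl hr) ↔ ∃ (j : ℕ) (hj : j < cnt K l r p), J = hubStates hl j (lt_of_lt_of_le hj (min_le_right _ _)) := by
  constructor
  · rintro ⟨k, hk⟩
    simp only [hubE, Prod.mk.injEq, hubPiece, Fin.ext_iff] at hk
    obtain ⟨hp, hs⟩ := hk
    refine ⟨(k : ℕ) % (K + 1 + l), ?_, hs.symm⟩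
    simp only [cnt, lt_min_iff]
    refine ⟨?_, pos_lt K l k⟩
    have := div_mul_add_mod' (k : ℕ) (K + 1 + l)
    rw [hp] at this
    have hk2 := k.2
    omega
  · rintro ⟨j, hj, rfl⟩
    have hj1 : j < r - (p : ℕ) * (K + 1 + l) := lt_of_lt_of_le hj (min_le_left _ _)
    have hj2 : j < K + 1 + l := lt_of_lt_of_le hj (min_le_right _ _)
    have hdiv : ((p : ℕ) * (K + 1 + l) + j) / (K + 1 + l) = p := by
      rw [Nat.mul_comm, Nat.mul_add_div (by omega), Nat.div_eq_of_lt hj2, add_zero]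
    have hmod : ((p : ℕ) * (K + 1 + l) + j) % (K + 1 + l) = j := by
      rw [Nat.mul_comm, Nat.mul_add_mod, Nat.mod_eq_of_lt hj2]
    refine ⟨⟨(p : ℕ) * (K + 1 + l) + j, by omega⟩, Prod.ext (Fin.ext hdiv) ?_⟩
    exact hubStates_congr hl (pos_lt K l _) hj2 hmod

/-- Members weigh at most `3`. -/
theorem weight_member_le (hl : l + 1 ≤ K) (p : Fin m) (j : ℕ) (hj : j < cnt K l r p) :
    hubW K l r p + ∑ q ∈ hubStates hl j (lt_of_lt_of_le hj (min_le_right _ _)), hubWt K l r p q ≤ 3 := by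
  have hjB : j < K + 1 + l := lt_of_lt_of_le hj (min_le_right _ _)
  have hc0 : cnt K l r p ≠ 0 := by omega
  by_cases hc1 : cnt K l r p = 1
  · have h0 : j = 0 := by omega
    simp [hubW, hubStates, h0, hc1]
  have hW : hubW K l r p = 0 := by simp [hubW, hc0, hc1]
  rw [hW, zero_add]
  by_cases h0 : j = 0
  · simp [hubStates, h0]
  by_cases hjK : j ≤ K
  · rw [hubStates_single hl j hjB h0 hjK, Finset.sum_singleton]
    simp only [hubWt]
    have hgt : ¬ cnt K l r p ≤ 1 := by omega
    rw [if_neg hgt]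
    by_cases hcK : cnt K l r p ≤ K + 1
    · rw [if_pos hcK, if_pos (by omega)]
    · rw [if_neg hcK]
      split_ifs <;> omega
  · rw [hubStates_pair hl j hjB (not_le.mp hjK), Finset.sum_pair (by intro heq; have := congrArg Fin.val heq; simp at this; omega)]
    simp only [hubWt]
    have hgt : ¬ cnt K l r p ≤ 1 := by omega
    have hcK : ¬ cnt K l r p ≤ K + 1 := by omega
    simp only [if_neg hgt, if_neg hcK, if_true]
    rw [if_neg (by omega), if_pos (by omega)]

/-- Non-members weigh at least `4`. -/
theorem four_le_weight_nonmember (hl : l + 1 ≤ K) (hr : r ≤ m * (K + 1 + l)) (x : Fin m × Finset (Fin K))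
    (hx : x ∉ Set.range (hubE hl hr)) : 4 ≤ hubW K l r x.1 + ∑ q ∈ x.2, hubWt K l r x.1 q := by
  obtain ⟨p, J⟩ := x
  have hmem := mem_range_hubE_iff hl hr p J
  simp only at hx ⊢
  by_contra hlt
  push Not at hlt
  apply hx
  rw [hmem]
  -- case analysis on cnt p
  by_cases hc0 : cnt K l r p = 0
  · simp [hubW, hc0] at hlt
  by_cases hc1 : cnt K l r p = 1
  · have hW : hubW K l r p = 3 := by simp [hubW, hc1]
    rw [hW] at hlt
    have hJ : J = ∅ := by
      by_contra hne
      obtain ⟨q, hq⟩ := Finset.nonempty_iff_ne_empty.mpr hne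
      have : hubWt K l r p q ≤ ∑ q ∈ J, hubWt K l r p q := Finset.single_le_sum (fun _ _ => Nat.zero_le _) hq
      have h1 : hubWt K l r p q = 1 := by simp [hubWt, hc1]
      omega
    exact ⟨0, by omega, by simp [hubStates, hJ]⟩
  have hW : hubW K l r p = 0 := by simp [hubW, hc0, hc1]
  rw [hW, zero_add] at hlt
  have hc2 : 2 ≤ cnt K l r p := by omega
  -- every state weighs at least 1, the sum is ≤ 3, so |J| ≤ 3; finer: use the minimum weights
  by_cases hcK : cnt K l r p ≤ K + 1
  · -- weights are 3 or 4: so |J| ≤ 1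
    have hwt : ∀ q, 3 ≤ hubWt K l r p q := fun q => by
      simp only [hubWt, if_neg (show ¬ cnt K l r p ≤ 1 by omega), if_pos hcK]; split_ifs <;> omega
    rcases J.eq_empty_or_nonempty with hJ | ⟨q, hq⟩
    · exact ⟨0, by omega, by simp [hubStates, hJ]⟩
    · have hJq : J = {q} := by
        refine Finset.eq_singleton_iff_unique_mem.mpr ⟨hq, fun q' hq' => ?_⟩
        by_contra hne
        have hsub : ({q, q'} : Finset (Fin K)) ⊆ J := by
          intro x hx; rcases Finset.mem_insert.mp hx with rfl | hx; exact hq; rw [Finset.mem_singleton.mp hx]; exact hq'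
        have := Finset.sum_le_sum_of_subset_of_nonneg (f := fun x => hubWt K l r p x) hsub
          (fun _ _ _ => Nat.zero_le _)
        rw [Finset.sum_pair (Ne.symm hne)] at this
        have h3 := hwt q; have h3' := hwt q'
        omega
      rw [hJq, Finset.sum_singleton] at hlt
      have hq2 : (q : ℕ) + 2 ≤ cnt K l r p := by
        simp only [hubWt, if_neg (show ¬ cnt K l r p ≤ 1 by omega), if_pos hcK] at hlt
        split_ifs at hlt with hh
        · exact hh
        · omega
      refine ⟨(q : ℕ) + 1, by omega, ?_⟩
      rw [hJq, hubStates_single hl _ _ (by omega) (by omega)]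
      congr 1
  · -- c ≥ K+2: hub 1, married 2, others 3
    have hcK' : K + 2 ≤ cnt K l r p := by omega
    have hwt1 : ∀ q, 1 ≤ hubWt K l r p q := fun q => by
      simp only [hubWt]; split_ifs <;> omega
    have hwt2 : ∀ q : Fin K, (q : ℕ) ≠ 0 → 2 ≤ hubWt K l r p q := fun q hq => by
      simp only [hubWt, if_neg (show ¬ cnt K l r p ≤ 1 by omega), if_neg hcK, if_neg hq]; split_ifs <;> omega
    have hwt0 : ∀ q : Fin K, (q : ℕ) = 0 → hubWt K l r p q = 1 := fun q hq => by
      simp only [hubWt, if_neg (show ¬ cnt K l r p ≤ 1 by omega), if_neg hcK, if_pos hq]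
    rcases J.eq_empty_or_nonempty with hJ | hne
    · exact ⟨0, by omega, by simp [hubStates, hJ]⟩
    -- J nonempty with total weight ≤ 3
    by_cases hcard : J.card = 1
    · obtain ⟨q, hJq⟩ := Finset.card_eq_one.mp hcard
      refine ⟨(q : ℕ) + 1, by have := q.2; omega, ?_⟩
      rw [hJq, hubStates_single hl _ _ (by omega) (by have := q.2; omega)]
      congr 1
    · -- |J| ≥ 2: then J contains 0 and exactly one married satellite
      have hcard2 : 2 ≤ J.card := by
        have := Finset.card_pos.mpr hne; omega
      -- the sum over J is ≥ sum of two smallest: if 0 ∉ J then ≥ 4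
      have h0mem : (⟨0, by omega⟩ : Fin K) ∈ J := by
        by_contra h0
        have : 2 * J.card ≤ ∑ q ∈ J, hubWt K l r p q := by
          rw [Finset.card_eq_sum_ones, Finset.mul_sum]
          exact Finset.sum_le_sum fun q hq => by
            have : (q : ℕ) ≠ 0 := fun hq0 => h0 (by have : q = ⟨0, by omega⟩ := Fin.ext hq0; rw [← this]; exact hq)
            have := hwt2 q this; omega
        omega
      -- J = {0} ∪ J', J' nonempty, weights ≥ 2 on J', total ≤ 3 ⇒ J' = {i} married
      set J' := J.erase ⟨0, by omega⟩ with hJ'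
      have hJ'card : J'.card = J.card - 1 := Finset.card_erase_of_mem h0mem
      have hsum : ∑ q ∈ J, hubWt K l r p q = 1 + ∑ q ∈ J', hubWt K l r p q := by
        rw [← Finset.add_sum_erase J _ h0mem, hwt0 _ rfl]
      have hJ'ne : J'.Nonempty := Finset.card_pos.mp (by omega)
      obtain ⟨i, hi⟩ := hJ'ne
      have hi0 : (i : ℕ) ≠ 0 := by
        intro hi0
        have : i = ⟨0, by omega⟩ := Fin.ext hi0
        rw [this] at hi
        exact Finset.notMem_erase _ _ hi
      have hJ'i : J' = {i} := by
        refine Finset.eq_singleton_iff_unique_mem.mpr ⟨hi, fun q' hq' => ?_⟩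
        by_contra hne'
        have hq'0 : (q' : ℕ) ≠ 0 := by
          intro h'; have : q' = ⟨0, by omega⟩ := Fin.ext h'; rw [this] at hq'; exact Finset.notMem_erase _ _ hq'
        have hsub : ({i, q'} : Finset (Fin K)) ⊆ J' := by
          intro x hx; rcases Finset.mem_insert.mp hx with rfl | hx; exact hi; rw [Finset.mem_singleton.mp hx]; exact hq'
        have := Finset.sum_le_sum_of_subset_of_nonneg (f := fun x => hubWt K l r p x) hsub
          (fun _ _ _ => Nat.zero_le _)
        rw [Finset.sum_pair (Ne.symm hne')] at this
        have h2 := hwt2 i hi0; have h2' := hwt2 q' hq'0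
        omega
      have hwi : hubWt K l r p i ≤ 2 := by
        rw [hsum, hJ'i, Finset.sum_singleton] at hlt; omega
      have hmar : (i : ℕ) + K + 1 ≤ cnt K l r p := by
        simp only [hubWt, if_neg (show ¬ cnt K l r p ≤ 1 by omega), if_neg hcK, if_neg hi0] at hwi
        split_ifs at hwi with hh
        · exact hh
        · omega
      have hJeq : J = {⟨0, by omega⟩, i} := by
        rw [← Finset.insert_erase h0mem, ← hJ', hJ'i]
      refine ⟨K + (i : ℕ), by omega, ?_⟩
      rw [hJeq, hubStates_pair hl _ _ (by omega)]
      (congr 2; try exact Fin.ext (by simp))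

/-- **The hub-join family is a strict threshold family** (hypothesis of the join doors / of the stubs). -/
theorem hub_threshold (hl : l + 1 ≤ K) (hr : r ≤ m * (K + 1 + l)) :
    ∀ x : Fin m × Finset (Fin K), x ∉ Set.range (hubE hl hr) →
      ∀ i, hubW K l r (hubE hl hr i).1 + ∑ k ∈ (hubE hl hr i).2, hubWt K l r (hubE hl hr i).1 k <
        hubW K l r x.1 + ∑ k ∈ x.2, hubWt K l r x.1 k := by
  intro x hx i
  have h4 := four_le_weight_nonmember hl hr x hx
  obtain ⟨j, hj, hJ⟩ := (mem_range_hubE_iff hl hr (hubE hl hr i).1 (hubE hl hr i).2).mp ⟨i, rfl⟩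
  have h3 := weight_member_le hl (hubE hl hr i).1 j hj
  rw [← hJ] at h3
  omega

end HubJoin

end

end Summit.ValiantsHypothesis.ValiantsHypothesis.Theorems.BarrierLever.HiddenStates
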